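import Literature.Probability.RandomPlanarGeometry.SAWLoopErasureKesten
import Literature.Probability.FitznerVanDerHofstad2017.NobleF3InitialPoint
import HarnessLib

/-!
# Hara–Slade–Sokal loop erasure with memory `τ = 2`: `μ(ℤ^d) ≥ (2d−1)/Π̃` and the printed `(2,0)` bound
`μ(ℤ^d) ≥ (2d−1)² / ((2d−2) G_d)` (`d ≥ 3`)

Topic `Literature/Probability/RandomPlanarGeometry`; a child of the tree's `SAWLoopErasureKesten.lean` (HSS93
(2.29) with memory `τ = 0`: the sets `avoidSet`, `sawAvoid`, `shiftSet`, `lastFiber`, `closedAvoid`, the shift lemma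
`sum_card_sawAvoid_shift_le`, the convolution bookkeeping `sum_convolution_mul_pow_le`, `sum_sum_range_convolution`,
`sum_triangle_comm` are used BY NAME) and of the tree's `FitznerVanDerHofstad2017/NobleF3InitialPoint.lean`, whose
`sum_range_nbwCountR_threshold_le : Σ_{n < N} (2d−1)^{−n} b_n(x) ≤ ρ_d · srwI d 1 0 x` (`ρ_d = nbwRho d = (2d−2)/(2d−1)`,
`G_d = srwI d 1 0 0 = C₀(0,0;1/2d)`) is exactly the `≤`-half of HSS93 (2.14) `C₂(0,x;1/(2d−1)) = ((2d−2)/(2d−1))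
C₀(0,x;1/2d)` (there cited to Fitzner–van der Hofstad's NoBLE (1.21)).  Here the SAME count-level loop erasure is run
on NON-BACKTRACKING words (memory `τ = 2`, `μ₂ = 2d − 1`, `β = 1/μ₂`), with the "second version" constraint of §2.4: a
closed loop erased at a pivot and followed by the backbone step `s` has its last step `≠ −s` (its next-to-last site avoids
the next backbone site), and — from the second pivot on — avoids the previous pivot, a neighbour `e_t` of its base with
`t ≠ s`.

## What the source prints (HSS93 = Hara–Slade–Sokal, J. Stat. Phys. 72 (1993) 479–517 = arXiv:hep-lat/9302003)

PDF p. 12 (printed p. 10), §2.3: "Next let us evaluate the bound (2.29) with memory `τ = 2`. Here `μ₂ = 2d − 1`. For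
`k = 0`, we conclude from (2.14) that `μ ≥ (2d−1)/C₂(0,0; 1/(2d−1)) = (2d−1)²/(2d−2) · 1/C₀(0,0; 1/2d)` (2.34). This bound
is nontrivial for `d > 2`, and is a factor `(2d−1)²/(2d(2d−2)) = 1 + 1/(2d(2d−2))` (2.35) better than the corresponding
bound (2.31) based on `τ = 0`."  §2.4 "Inequalities (second version)": "For any memory `τ ≥ 2`, we can improve these
results by using (2.18)/(2.20), i.e. by taking into account the further constraint that the next-to-last site of the
loop avoid the next site of the backbone. The analysis given previously can be repeated almost verbatim in this case. We
introduce `Π̃_τ(k;β) = max_{A,e} C̃^{A;e}_τ(0,0;β)` (2.36) where the maximum ranges over all `k`-element sets `A` which are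
the range of a `(k−1)`-step self-avoiding walk starting at a nearest neighbour of the origin, and over all nearest
neighbours `e` of the origin satisfying `e ∉ A`."  PDF p. 13 (printed p. 11): "Arguing as before, we have
`μ ≥ μ_τ / Π̃_τ(k; μ_τ^{−1})` for `τ = 2, k ≥ 0, d > 0` (2.39)".  PDF p. 14, Table 2, row `(2,0)`: `d = 3`: 4.121 641;
`d = 4`: 6.588 853; `d = 5`: 8.756 316; `d = 6`: 10.832 942 ("truncated to give rigorous lower bounds").

## What is typed (standard axioms; no `sorry`; every generating function as PARTIAL SUMS at `β = 1/(2d−1)`)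

* the count-level engine of (2.36)/(2.39) for `τ = 2`, `k = 1`: the finite sets `nbwAvoid A n` (NBW words avoiding
  `A`), `closedNbwPen A s σ` (closed NBW `σ`-loops at `0` avoiding `A` whose last step is not `−s`), the penalised loop
  numbers `nbwLoopsPen d σ = max_{t ≠ s} #closedNbwPen {e_t} s σ` (= the coefficients of `Π̃₂(1;·)`, as a maximum over
  the geometry instead of the symmetric value), the fibre bound `card_lastFiberN_le` (split at the last visit to `0`:
  loop, step `s`, tail — the word is non-backtracking across both junctions, the second junction being absorbed by the
  tail's avoidance of the pivot), the decoration step `nbwAvoid_card_step` and the two count inequalities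
  `nbwAvoid_card_le_pen`, `card_nbwWords_le_sum : b_n ≤ Σ_{m ≤ n} c_m U(m+1, n−m)` with the loop tuples
  `penTuples` (first loop free of the neighbour constraint, last loop free of the step constraint);
* the limit argument at a general fugacity, `div_le_connectiveConstant_of : (∀ N, N+1 ≤ Σ_{m ≤ N} c_m β^m C W^m) →
  1/(βW) ≤ μ(ℤ^d)`, and `succ_le_sum_count_mul_pow_of_nbw` (`b_n (2d−1)^{−n} ≥ 1`);
* **`hss_memoryTwo_div_le_connectiveConstant (hd : 3 ≤ d)`: if `Σ_{j ≤ K} nbwLoopsPen d j (2d−1)^{−j} ≤ W` for every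
  `K` (`W > 0`) then `(2d−1)/W ≤ μ(ℤ^d)`** — (2.39) with `τ = 2`, `k = 1`, the denominator `Π̃₂(1; 1/(2d−1))` replaced by
  any bound `W` on its defining partial sums (a successor module is to supply `W = ((2d−2)/(2d−1)) G_d −
  (6d−8)/(2d−1)⁴` from the three square families violating the constraints at `σ = 4`);
* **`hss_two_zero_le_connectiveConstant (hd : 3 ≤ d) : (2d−1)²/((2d−2) G_d) ≤ μ(ℤ^d)`** — (2.34) AS PRINTED, i.e. the
  Table 2 row `(2,0)` as a function of the tree's real number `G_d = C₀(0,0;1/2d) = srwI d 1 0 0` (no decimal value of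
  `G_d` is asserted here).

NOT CLAIMED: the symmetric evaluation of `Π̃₂` by the linear systems of §3.2–3.3 ((2.40), Table 2 rows `(2̃,k)`), the
case `d ≤ 2` of (2.34) (trivial there), memories `τ ≥ 4`.  Label (proposed): PORT of (2.39) [`τ = 2`, `k = 1`, with
`Π̃` as a hypothesis-bounded partial sum] ∧ (2.34) AS PRINTED; a child of `SAWLoopErasureKesten` and
`NobleF3InitialPoint` (both in the tree).
-/

noncomputable section

namespace Literature.Probability.RandomPlanarGeometry.SAW.Zd.LoopErasure

open Finset Filter Topology
open scoped BigOperators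
open Literature.Probability.LatticeModels Literature.Probability.LatticeModels.SRW
open Literature.Barriers.CriticalPhenomena Literature.Barriers.CriticalPhenomena.SAWLace
open Literature.Probability.FitznerVanDerHofstad2017
open Literature.Probability.Percolation (IsNBW nbwWords nbwWordsTo mem_nbwWords srev srev_srev)

variable {d : ℕ}

/-! ### Sub-words of non-backtracking words -/

/-- A prefix of a non-backtracking word is non-backtracking. [cite: MadrasSlade1993, §1.2 (memory 2 rules out immediate reversals; lane plumbing)] -/
theorem isNBW_castAdd {m k : ℕ} {ω : StepSeq d (m + k)} (h : IsNBW ω) :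
    IsNBW (fun i : Fin m => ω (Fin.castAdd k i)) :=
  fun j hj => h j (by omega)

/-- A suffix of a non-backtracking word is non-backtracking. [cite: MadrasSlade1993, §1.2 (memory 2 rules out immediate reversals; lane plumbing)] -/
theorem isNBW_natAdd {m k : ℕ} {ω : StepSeq d (m + k)} (h : IsNBW ω) :
    IsNBW (fun i : Fin k => ω (Fin.natAdd m i)) := by
  intro j hj
  have h' := h (m + j) (by omega)
  have e1 : (Fin.natAdd m ⟨j + 1, hj⟩ : Fin (m + k)) = ⟨m + j + 1, by omega⟩ :=
    Fin.ext (by simp only [Fin.val_natAdd]; omega)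
  have e2 : (Fin.natAdd m ⟨j, by omega⟩ : Fin (m + k)) = ⟨m + j, by omega⟩ :=
    Fin.ext (by simp only [Fin.val_natAdd])
  show ω (Fin.natAdd m ⟨j + 1, hj⟩) ≠ srev (ω (Fin.natAdd m ⟨j, by omega⟩))
  rw [e1, e2]
  exact h'

/-! ### Non-backtracking words avoiding a finite set; closed NBW loops, plain and penalised -/

open Classical in
/-- The `n`-step NON-BACKTRACKING words whose positions at times `0, …, n` avoid `A`.
[cite: HaraSladeSokal1993, §2.4 eq. (2.36)–(2.39) p. 10–11 (lane plumbing for the memory-2 loop erasure)] -/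
def nbwAvoid (A : Finset (Site d)) (n : ℕ) : Finset (StepSeq d n) :=
  (avoidSet A n).filter fun ω => IsNBW ω

/-- Membership in `nbwAvoid`. [cite: HaraSladeSokal1993, §2.4 eq. (2.36)–(2.39) p. 10–11 (lane plumbing for the memory-2 loop erasure)] -/
theorem mem_nbwAvoid {A : Finset (Site d)} {n : ℕ} {ω : StepSeq d n} :
    ω ∈ nbwAvoid A n ↔ IsNBW ω ∧ ∀ t ≤ n, pos ω t ∉ A := by
  classical
  rw [nbwAvoid, Finset.mem_filter, mem_avoidSet, and_comm]

/-- If `0 ∈ A` no word avoids `A`. [cite: HaraSladeSokal1993, §2.4 eq. (2.36)–(2.39) p. 10–11 (lane plumbing for the memory-2 loop erasure)] -/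
theorem nbwAvoid_eq_empty_of_mem {A : Finset (Site d)} (h : (0 : Site d) ∈ A) (n : ℕ) : nbwAvoid A n = ∅ := by
  classical
  rw [nbwAvoid, avoidSet_eq_empty_of_mem h, Finset.filter_empty]

/-- `nbwAvoid ∅ n` is the set of all non-backtracking words. [cite: HaraSladeSokal1993, §2.4 eq. (2.36)–(2.39) p. 10–11 (lane plumbing for the memory-2 loop erasure)] -/
theorem card_nbwAvoid_empty (n : ℕ) : (nbwAvoid (∅ : Finset (Site d)) n).card = (nbwWords d n).card := by
  classical
  congr 1
  ext ω
  simp only [mem_nbwAvoid, Finset.notMem_empty, not_false_eq_true, implies_true, and_true, mem_nbwWords]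

open Classical in
/-- The NBW words avoiding `A` whose last visit to `0` among the times `0, …, n` happens at time `σ`.
[cite: HaraSladeSokal1993, §2.4 eq. (2.36)–(2.39) p. 10–11 (lane plumbing for the memory-2 loop erasure)] -/
def lastFiberN (A : Finset (Site d)) (n σ : ℕ) : Finset (StepSeq d n) :=
  (lastFiber A n σ).filter fun ω => IsNBW ω

/-- Transport of the fibre cardinality along `n = n'`. [cite: HaraSladeSokal1993, §2.4 eq. (2.36)–(2.39) p. 10–11 (lane plumbing for the memory-2 loop erasure)] -/
theorem card_lastFiberN_congr {n n' : ℕ} (h : n = n') (A : Finset (Site d)) (σ : ℕ) :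
    (lastFiberN A n σ).card = (lastFiberN A n' σ).card := by
  subst h; rfl

/-- Every word has a last visit to the origin. [cite: HaraSladeSokal1993, §2.4 eq. (2.36)–(2.39) p. 10–11 (lane plumbing for the memory-2 loop erasure)] -/
theorem nbwAvoid_subset_biUnion (A : Finset (Site d)) (n : ℕ) :
    nbwAvoid A n ⊆ (range (n + 1)).biUnion (lastFiberN A n) := by
  classical
  intro ω hω
  rw [nbwAvoid, Finset.mem_filter] at hω
  have h := avoidSet_subset_biUnion A n hω.1
  rw [Finset.mem_biUnion] at h ⊢
  obtain ⟨σ, hσ, hmem⟩ := h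
  exact ⟨σ, hσ, Finset.mem_filter.2 ⟨hmem, hω.2⟩⟩

/-- `#nbwAvoid A n ≤ Σ_σ #lastFiberN A n σ`. [cite: HaraSladeSokal1993, §2.4 eq. (2.36)–(2.39) p. 10–11 (lane plumbing for the memory-2 loop erasure)] -/
theorem card_nbwAvoid_le_sum (A : Finset (Site d)) (n : ℕ) :
    (nbwAvoid A n).card ≤ ∑ σ ∈ range (n + 1), (lastFiberN A n σ).card :=
  (Finset.card_le_card (nbwAvoid_subset_biUnion A n)).trans Finset.card_biUnion_le

open Classical in
/-- The closed non-backtracking `σ`-loops at `0` (`b_σ(0)` of them).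
[cite: HaraSladeSokal1993, §2.1 eq. (2.2) p. 4 (c_{N,2}(0,0); lane plumbing)] -/
def closedNbw (d σ : ℕ) : Finset (StepSeq d σ) :=
  Finset.univ.filter fun ω => IsNBW ω ∧ endpoint ω = 0

/-- `b_σ(0)`, the number of closed non-backtracking `σ`-loops (the coefficients of `C₂(0,0;β)`).
[cite: HaraSladeSokal1993, §2.1 eq. (2.2) p. 4 (c_{N,2}(0,0); lane plumbing)] -/
def nbwLoopsAll (d σ : ℕ) : ℕ := (closedNbw d σ).card

/-- `closedNbw d σ` is the tree's `nbwWordsTo d σ 0`. [cite: HaraSladeSokal1993, §2.1 eq. (2.2) p. 4 (c_{N,2}(0,0); lane plumbing)] -/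
theorem closedNbw_eq_nbwWordsTo (σ : ℕ) : closedNbw d σ = nbwWordsTo d σ 0 := by
  classical
  ext ω
  simp only [closedNbw, nbwWordsTo, Finset.mem_filter, Finset.mem_univ, true_and, mem_nbwWords,
    wordPos_eq_endpoint]

/-- `nbwLoopsAll d σ = b_σ(0) = #nbwWordsTo d σ 0`. [cite: HaraSladeSokal1993, §2.1 eq. (2.2) p. 4 (c_{N,2}(0,0); lane plumbing)] -/
theorem nbwLoopsAll_eq_card_nbwWordsTo (σ : ℕ) : nbwLoopsAll d σ = (nbwWordsTo d σ 0).card := by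
  rw [nbwLoopsAll, closedNbw_eq_nbwWordsTo]

open Classical in
/-- The closed NBW `σ`-loops at `0` avoiding `A` whose LAST step is not `−s` (their next-to-last site is not `e_s`,
the next backbone site): the loops counted by `C̃^{A;e_s}₂(0,0;·)`.
[cite: HaraSladeSokal1993, §2.4 eq. (2.36) p. 10 (C̃^{A;e}_τ: "the next-to-last site of the loop avoid the next site of the backbone")] -/
def closedNbwPen (A : Finset (Site d)) (s : Dir d) (σ : ℕ) : Finset (StepSeq d σ) :=
  (closedAvoid A σ).filter fun ω => IsNBW ω ∧ ∀ i : Fin σ, (i : ℕ) + 1 = σ → ω i ≠ srev s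

/-- Membership in `closedNbwPen`. [cite: HaraSladeSokal1993, §2.4 eq. (2.36) p. 10 (lane plumbing)] -/
theorem mem_closedNbwPen {A : Finset (Site d)} {s : Dir d} {σ : ℕ} {ω : StepSeq d σ} :
    ω ∈ closedNbwPen A s σ ↔ (endpoint ω = 0 ∧ ∀ t, t ≤ σ → pos ω t ∉ A) ∧
      (IsNBW ω ∧ ∀ i : Fin σ, (i : ℕ) + 1 = σ → ω i ≠ srev s) := by
  classical
  rw [closedNbwPen, Finset.mem_filter, mem_closedAvoid]

/-- `#closedNbwPen A s σ ≤ b_σ(0)`. [cite: HaraSladeSokal1993, §2.4 eq. (2.36) p. 10 (lane plumbing)] -/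
theorem card_closedNbwPen_le_nbwLoopsAll (A : Finset (Site d)) (s : Dir d) (σ : ℕ) :
    (closedNbwPen A s σ).card ≤ nbwLoopsAll d σ := by
  classical
  refine Finset.card_le_card fun ω hω => ?_
  rw [mem_closedNbwPen] at hω
  rw [closedNbw, Finset.mem_filter]
  exact ⟨Finset.mem_univ _, hω.2.1, hω.1.1⟩

/-- Monotonicity in the obstacle. [cite: HaraSladeSokal1993, §2.4 eq. (2.36) p. 10 (lane plumbing)] -/
theorem card_closedNbwPen_mono {A B : Finset (Site d)} (h : B ⊆ A) (s : Dir d) (σ : ℕ) :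
    (closedNbwPen A s σ).card ≤ (closedNbwPen B s σ).card := by
  refine Finset.card_le_card fun ω hω => ?_
  rw [mem_closedNbwPen] at hω ⊢
  exact ⟨⟨hω.1.1, fun t ht hB => hω.1.2 t ht (h hB)⟩, hω.2⟩

/-- **The penalised loop numbers** `w̃_σ := max over ordered pairs of directions t ≠ s of
#{closed NBW σ-loops at 0 avoiding e_t whose last step is not −s}` — the coefficients of `Π̃₂(1;β)` of (2.36), taken as a
maximum over the geometry `(A, e) = ({e_t}, e_s)` (all these numbers coincide for `e_s ⟂ e_t` resp. `e_s = −e_t` by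
symmetry; the maximum avoids proving it). [cite: HaraSladeSokal1993, §2.4 eq. (2.36) p. 10 (Π̃_τ(k;β) = max_{A,e} C̃^{A;e}_τ(0,0;β), k = 1)] -/
def nbwLoopsPen (d σ : ℕ) : ℕ :=
  ((Finset.univ : Finset (Dir d × Dir d)).filter fun p => p.1 ≠ p.2).sup
    fun p => (closedNbwPen {stepVec p.1} p.2 σ).card

/-- For `t ≠ s`, `#closedNbwPen {e_t} s σ ≤ w̃_σ` (a term of the maximum).
[cite: HaraSladeSokal1993, §2.4 eq. (2.36) p. 10 (lane plumbing)] -/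
theorem card_closedNbwPen_singleton_le_nbwLoopsPen {t s : Dir d} (hts : t ≠ s) (σ : ℕ) :
    (closedNbwPen {stepVec t} s σ).card ≤ nbwLoopsPen d σ := by
  have hmem : (t, s) ∈ (Finset.univ : Finset (Dir d × Dir d)).filter (fun p => p.1 ≠ p.2) :=
    Finset.mem_filter.2 ⟨Finset.mem_univ _, hts⟩
  have h := Finset.le_sup (f := fun p : Dir d × Dir d => (closedNbwPen {stepVec p.1} p.2 σ).card) hmem
  exact h

/-- If `A` contains the neighbour `e_t` and not `e_s` then `#closedNbwPen A s σ ≤ w̃_σ`.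
[cite: HaraSladeSokal1993, §2.4 eq. (2.36) p. 10 (lane plumbing)] -/
theorem card_closedNbwPen_le_nbwLoopsPen {A : Finset (Site d)} {t s : Dir d} (ht : stepVec t ∈ A)
    (hs : stepVec s ∉ A) (σ : ℕ) : (closedNbwPen A s σ).card ≤ nbwLoopsPen d σ := by
  have hts : t ≠ s := by
    rintro rfl
    exact hs ht
  exact (card_closedNbwPen_mono (Finset.singleton_subset_iff.2 ht) s σ).trans
    (card_closedNbwPen_singleton_le_nbwLoopsPen hts σ)

/-- `w̃_σ ≤ b_σ(0)`. [cite: HaraSladeSokal1993, §2.4 eq. (2.36) p. 10 (lane plumbing)] -/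
theorem nbwLoopsPen_le (σ : ℕ) : nbwLoopsPen d σ ≤ nbwLoopsAll d σ :=
  Finset.sup_le fun _ _ => card_closedNbwPen_le_nbwLoopsAll _ _ σ

/-! ### Splitting a non-backtracking word at its last visit to the origin -/

/-- The fibre `σ = n`: closed NBW loops. [cite: HaraSladeSokal1993, §2.4 eq. (2.36)–(2.39) p. 10–11 (lane plumbing for the memory-2 loop erasure)] -/
theorem card_lastFiberN_self_le (A : Finset (Site d)) (n : ℕ) : (lastFiberN A n n).card ≤ nbwLoopsAll d n := by
  classical
  refine Finset.card_le_card fun ω hω => ?_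
  rw [lastFiberN, Finset.mem_filter, lastFiber, Finset.mem_filter, mem_avoidSet] at hω
  rw [closedNbw, Finset.mem_filter]
  exact ⟨Finset.mem_univ _, hω.2, by rw [← pos_eq_endpoint]; exact hω.1.2.1⟩

/-- **The fibre `σ < n = σ + (1 + r)` for non-backtracking words**: a closed NBW loop of length `σ` avoiding `A` whose
last step is not the reversal of the next step `s`, the step `s`, and an NBW word of length `r` avoiding `(A ∪ {0}) − e_s`
— injectively (non-backtracking at the second junction is part of the tail's avoidance of `−e_s`).
[cite: HaraSladeSokal1993, §2.4 eq. (2.36)–(2.37) p. 10 ("the next-to-last site of the loop avoid the next site of the backbone")] -/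
theorem card_lastFiberN_le (A : Finset (Site d)) (σ r : ℕ) :
    (lastFiberN A (σ + (1 + r)) σ).card ≤
      ∑ s : Dir d, (closedNbwPen A s σ).card * (nbwAvoid (shiftSet A s) r).card := by
  classical
  have hcard : ∑ s : Dir d, (closedNbwPen A s σ).card * (nbwAvoid (shiftSet A s) r).card =
      ((Finset.univ : Finset (Dir d)).sigma fun s => closedNbwPen A s σ ×ˢ nbwAvoid (shiftSet A s) r).card := by
    rw [Finset.card_sigma]
    exact Finset.sum_congr rfl fun s _ => (Finset.card_product _ _).symm
  rw [hcard]
  refine Finset.card_le_card_of_injOn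
    (fun ω : StepSeq d (σ + (1 + r)) =>
      (⟨((Fin.appendEquiv 1 r).symm ((Fin.appendEquiv σ (1 + r)).symm ω).2).1 0,
        (((Fin.appendEquiv σ (1 + r)).symm ω).1,
          ((Fin.appendEquiv 1 r).symm ((Fin.appendEquiv σ (1 + r)).symm ω).2).2)⟩ :
        Σ _ : Dir d, StepSeq d σ × StepSeq d r))
    ?_ ?_
  · intro ω hω
    rw [Finset.mem_coe, lastFiberN, Finset.mem_filter, lastFiber, Finset.mem_filter, mem_avoidSet] at hω
    obtain ⟨⟨hav, hσ0, hlast⟩, hnb⟩ := hω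
    set p := (Fin.appendEquiv σ (1 + r)).symm ω with hp
    set q := (Fin.appendEquiv 1 r).symm p.2 with hq
    have hω1 : Fin.append p.1 p.2 = ω := (Fin.appendEquiv σ (1 + r)).apply_symm_apply ω
    have hp2 : Fin.append q.1 q.2 = p.2 := (Fin.appendEquiv 1 r).apply_symm_apply p.2
    have hp1 : ∀ t, t ≤ σ → pos p.1 t = pos ω t := by
      intro t ht; rw [← pos_append_of_le p.1 p.2 ht, hω1]
    have hp1σ : pos p.1 σ = 0 := by rw [hp1 σ le_rfl, hσ0]
    -- positions of the tail: `pos q.2 k + e_s = pos ω (σ + (1 + k))`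
    have hposω : ∀ k, pos ω (σ + (1 + k)) = pos q.2 k + stepVec (q.1 0) := by
      intro k
      rw [← hω1, pos_append_add, ← hp2, pos_append_add, pos_one_eq_stepVec, hp1σ, zero_add, add_comm]
    -- non-backtracking of the parts and at the first junction
    have hnb1 : IsNBW p.1 := isNBW_castAdd hnb
    have hnb2 : IsNBW q.2 := isNBW_natAdd (isNBW_natAdd hnb)
    have hjct : ∀ i : Fin σ, (i : ℕ) + 1 = σ → p.1 i ≠ srev (q.1 0) := by
      intro i hi heq
      have h' := hnb i (by omega)
      have e1 : (⟨(i : ℕ) + 1, by omega⟩ : Fin (σ + (1 + r))) = Fin.natAdd σ (Fin.castAdd r (0 : Fin 1)) :=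
        Fin.ext (by simp only [Fin.val_natAdd, Fin.val_castAdd, Fin.val_zero]; omega)
      have e2 : (⟨(i : ℕ), by omega⟩ : Fin (σ + (1 + r))) = Fin.castAdd (1 + r) i := Fin.ext (by simp)
      rw [e1, e2] at h'
      have h3 : q.1 0 ≠ srev (p.1 i) := h'
      exact h3 (by rw [heq, srev_srev])
    rw [Finset.mem_coe, Finset.mem_sigma, Finset.mem_product, mem_closedNbwPen, mem_nbwAvoid]
    refine ⟨Finset.mem_univ _, ⟨⟨?_, fun t ht => ?_⟩, hnb1, hjct⟩, hnb2, fun k hk hmem => ?_⟩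
    · rw [← pos_eq_endpoint, hp1σ]
    · rw [hp1 t ht]; exact hav t (by omega)
    · rw [mem_shiftSet, ← hposω k, Finset.mem_insert] at hmem
      rcases hmem with h | h
      · exact hlast (σ + (1 + k)) (by omega) (by omega) h
      · exact hav (σ + (1 + k)) (by omega) h
  · intro ω _ ω' _ h
    simp only [Sigma.mk.inj_iff, heq_eq_eq, Prod.mk.injEq] at h
    obtain ⟨h2, h1, h3⟩ := h
    have hq : (Fin.appendEquiv 1 r).symm ((Fin.appendEquiv σ (1 + r)).symm ω).2 =
        (Fin.appendEquiv 1 r).symm ((Fin.appendEquiv σ (1 + r)).symm ω').2 := by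
      refine Prod.ext ?_ h3
      funext i
      rw [Fin.fin_one_eq_zero i]
      exact h2
    have hp2 : ((Fin.appendEquiv σ (1 + r)).symm ω).2 = ((Fin.appendEquiv σ (1 + r)).symm ω').2 :=
      (Fin.appendEquiv 1 r).symm.injective hq
    exact (Fin.appendEquiv σ (1 + r)).symm.injective (Prod.ext h1 hp2)

/-! ### Loop tuples with a free last loop; the decoration step -/

/-- `U^{v₁;v,v₀}_r(k)`: `r`-tuples of loops of total length `k`, the FIRST loop counted by `v₁`, the LAST by `v₀` and the
others by `v` (a single loop is a last loop).  In the memory-2 loop erasure the last restored loop carries no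
"next step" constraint. [cite: HaraSladeSokal1993, §2.4 eq. (2.37)–(2.38) p. 10 (lane plumbing: the loop tuples of the second version)] -/
def penTuples (v v₀ : ℕ → ℕ) : (ℕ → ℕ) → ℕ → ℕ → ℕ
  | _, 0, k => if k = 0 then 1 else 0
  | _, 1, k => v₀ k
  | v₁, r + 2, k => ∑ σ ∈ range (k + 1), v₁ σ * penTuples v v₀ v (r + 1) (k - σ)

/-- `U_1(k) = v₀(k)`. [cite: HaraSladeSokal1993, §2.4 eq. (2.37)–(2.38) p. 10 (lane plumbing)] -/
theorem penTuples_one (v v₀ v₁ : ℕ → ℕ) (k : ℕ) : penTuples v v₀ v₁ 1 k = v₀ k := rfl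

/-- The convolution recursion `U^{v₁}_{r+2}(k) = Σ_σ v₁(σ) U^{v}_{r+1}(k − σ)`. [cite: HaraSladeSokal1993, §2.4 eq. (2.37)–(2.38) p. 10 (lane plumbing)] -/
theorem penTuples_succ_succ (v v₀ v₁ : ℕ → ℕ) (r k : ℕ) :
    penTuples v v₀ v₁ (r + 2) k = ∑ σ ∈ range (k + 1), v₁ σ * penTuples v v₀ v (r + 1) (k - σ) := rfl

/-- **The decoration step, memory 2.** If the penalised closed NBW loops avoiding `A` are counted by `v₁` (for every
next step `s` with `e_s ∉ A`) and, recursively, the NBW words of length `< n` avoiding the shifted obstacles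
`(A ∪ {0}) − e_s` obey the decoration inequality with middle loop numbers `v`, then the `n`-step NBW words avoiding `A`
obey it with first loop numbers `v₁`. [cite: HaraSladeSokal1993, §2.4 eq. (2.36)–(2.37) p. 10] -/
theorem nbwAvoid_card_step (v₁ v : ℕ → ℕ) (n : ℕ) (A : Finset (Site d)) (h0 : (0 : Site d) ∉ A)
    (hv₁ : ∀ (s : Dir d) (σ : ℕ), stepVec s ∉ A → (closedNbwPen A s σ).card ≤ v₁ σ)
    (hrec : ∀ s : Dir d, (0 : Site d) ∉ shiftSet A s → ∀ r, r < n →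
      (nbwAvoid (shiftSet A s) r).card ≤
        ∑ m ∈ range (r + 1), (sawAvoid (shiftSet A s) m).card *
          penTuples v (nbwLoopsAll d) v (m + 1) (r - m)) :
    (nbwAvoid A n).card ≤
      ∑ m ∈ range (n + 1), (sawAvoid A m).card * penTuples v (nbwLoopsAll d) v₁ (m + 1) (n - m) := by
  -- the fibres `σ < n`
  have hfib : ∀ σ ∈ range n, (lastFiberN A n σ).card ≤ v₁ σ *
      ∑ m ∈ range (n - σ), penTuples v (nbwLoopsAll d) v (m + 1) (n - σ - 1 - m) * (sawAvoid A (m + 1)).card := by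
    intro σ hσ
    rw [Finset.mem_range] at hσ
    rw [card_lastFiberN_congr (show n = σ + (1 + (n - σ - 1)) by omega)]
    refine (card_lastFiberN_le A σ (n - σ - 1)).trans ?_
    have hstep : ∑ s : Dir d, (closedNbwPen A s σ).card * (nbwAvoid (shiftSet A s) (n - σ - 1)).card ≤
        v₁ σ * ∑ s : Dir d, (nbwAvoid (shiftSet A s) (n - σ - 1)).card := by
      rw [Finset.mul_sum]
      refine Finset.sum_le_sum fun s _ => ?_
      by_cases hs : stepVec s ∈ A
      · have h0' : (0 : Site d) ∈ shiftSet A s := by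
          rw [mem_shiftSet, zero_add]; exact Finset.mem_insert_of_mem hs
        rw [nbwAvoid_eq_empty_of_mem h0', Finset.card_empty, mul_zero, mul_zero]
      · exact Nat.mul_le_mul_right _ (hv₁ s σ hs)
    refine hstep.trans (Nat.mul_le_mul_left _ ?_)
    calc ∑ s : Dir d, (nbwAvoid (shiftSet A s) (n - σ - 1)).card
        ≤ ∑ s : Dir d, ∑ m ∈ range (n - σ - 1 + 1),
            (sawAvoid (shiftSet A s) m).card * penTuples v (nbwLoopsAll d) v (m + 1) (n - σ - 1 - m) := by
          refine Finset.sum_le_sum fun s _ => ?_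
          by_cases hs : (0 : Site d) ∈ shiftSet A s
          · rw [nbwAvoid_eq_empty_of_mem hs, Finset.card_empty]; exact Nat.zero_le _
          · exact hrec s hs (n - σ - 1) (by omega)
      _ = ∑ m ∈ range (n - σ), penTuples v (nbwLoopsAll d) v (m + 1) (n - σ - 1 - m) *
            ∑ s : Dir d, (sawAvoid (shiftSet A s) m).card := by
          rw [Finset.sum_comm, show n - σ - 1 + 1 = n - σ by omega]
          refine Finset.sum_congr rfl fun m _ => ?_
          rw [Finset.mul_sum]
          refine Finset.sum_congr rfl fun s _ => ?_
          ring
      _ ≤ ∑ m ∈ range (n - σ), penTuples v (nbwLoopsAll d) v (m + 1) (n - σ - 1 - m) *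
            (sawAvoid A (m + 1)).card := by
          refine Finset.sum_le_sum fun m _ => Nat.mul_le_mul_left _ ?_
          exact sum_card_sawAvoid_shift_le h0 m
  calc (nbwAvoid A n).card ≤ ∑ σ ∈ range (n + 1), (lastFiberN A n σ).card := card_nbwAvoid_le_sum A n
    _ = ∑ σ ∈ range n, (lastFiberN A n σ).card + (lastFiberN A n n).card := Finset.sum_range_succ _ _
    _ ≤ ∑ σ ∈ range n, v₁ σ *
          ∑ m ∈ range (n - σ), penTuples v (nbwLoopsAll d) v (m + 1) (n - σ - 1 - m) * (sawAvoid A (m + 1)).card +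
          nbwLoopsAll d n := add_le_add (Finset.sum_le_sum hfib) (card_lastFiberN_self_le A n)
    _ = ∑ m ∈ range n, (sawAvoid A (m + 1)).card * penTuples v (nbwLoopsAll d) v₁ (m + 1 + 1) (n - (m + 1)) +
          (sawAvoid A 0).card * penTuples v (nbwLoopsAll d) v₁ (0 + 1) (n - 0) := by
        rw [card_sawAvoid_zero h0, one_mul, Nat.sub_zero, zero_add, penTuples_one]
        congr 1
        simp_rw [Finset.mul_sum]
        rw [sum_triangle_comm n]
        refine Finset.sum_congr rfl fun m hm => ?_
        rw [Finset.mem_range] at hm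
        rw [show m + 1 + 1 = m + 2 from rfl, penTuples_succ_succ, show n - (m + 1) + 1 = n - m by omega,
          Finset.mul_sum]
        refine Finset.sum_congr rfl fun σ _ => ?_
        rw [show n - (m + 1) - σ = n - σ - 1 - m by omega]
        ring
    _ = ∑ m ∈ range (n + 1), (sawAvoid A m).card * penTuples v (nbwLoopsAll d) v₁ (m + 1) (n - m) :=
        (Finset.sum_range_succ' (fun m => (sawAvoid A m).card *
          penTuples v (nbwLoopsAll d) v₁ (m + 1) (n - m)) n).symm

/-- **The memory-2 loop-erasure inequality from the second pivot on** (`k = 1`, second version): if `0 ∉ A` and `A`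
contains a neighbour of the origin, then `#{n-step NBW words avoiding A} ≤ Σ_{m ≤ n} #{m-step SAWs avoiding A} ·
U^{w̃;w̃,b}_{m+1}(n − m)` — every restored loop but the last avoids the previous pivot and does not end with the reversal
of the next backbone step. [cite: HaraSladeSokal1993, §2.4 eq. (2.36)–(2.37) p. 10 (τ = 2, k = 1)] -/
theorem nbwAvoid_card_le_pen (n : ℕ) : ∀ A : Finset (Site d), (0 : Site d) ∉ A → (∃ t : Dir d, stepVec t ∈ A) →
    (nbwAvoid A n).card ≤ ∑ m ∈ range (n + 1),
      (sawAvoid A m).card * penTuples (nbwLoopsPen d) (nbwLoopsAll d) (nbwLoopsPen d) (m + 1) (n - m) := by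
  induction n using Nat.strong_induction_on with
  | _ n ih =>
  intro A h0 hA
  obtain ⟨t, ht⟩ := hA
  exact nbwAvoid_card_step (nbwLoopsPen d) (nbwLoopsPen d) n A h0
    (fun s σ hs => card_closedNbwPen_le_nbwLoopsPen ht hs σ)
    (fun s hs r hr => ih r hr _ hs ⟨s.neg, by rw [stepVec_neg]; exact neg_stepVec_mem_shiftSet A s⟩)

/-- **`b_n ≤ Σ_{m ≤ n} c_m U^{b;w̃,b}_{m+1}(n − m)`**: every `n`-step non-backtracking word is a self-avoiding walk
decorated with closed NBW loops, the loop at the `j`-th pivot (`1 ≤ j < m`) avoiding the `(j−1)`-st pivot and not ending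
with the reversal of the `(j+1)`-st backbone step. [cite: HaraSladeSokal1993, §2.4 eq. (2.37) p. 10 (summed over x, τ = 2, k = 1)] -/
theorem card_nbwWords_le_sum (n : ℕ) :
    (nbwWords d n).card ≤ ∑ m ∈ range (n + 1),
      count d m * penTuples (nbwLoopsPen d) (nbwLoopsAll d) (nbwLoopsAll d) (m + 1) (n - m) := by
  have h := nbwAvoid_card_step (nbwLoopsAll d) (nbwLoopsPen d) n (∅ : Finset (Site d)) (Finset.notMem_empty _)
    (fun s σ _ => card_closedNbwPen_le_nbwLoopsAll _ s σ)
    (fun s hs r _ => nbwAvoid_card_le_pen r _ hs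
      ⟨s.neg, by rw [stepVec_neg]; exact neg_stepVec_mem_shiftSet _ s⟩)
  rw [card_nbwAvoid_empty] at h
  simpa only [card_sawAvoid_empty] using h

/-! ### Generating-function bookkeeping for `penTuples` -/

/-- `Σ_{k ≤ K} U^{v₁}_{r+2}(k) βᵏ ≤ (Σ v₁ βʲ)(Σ v βʲ)^r (Σ v₀ βʲ)` for `β ≥ 0`.
[cite: HaraSladeSokal1993, §2.4 eq. (2.37)–(2.38) p. 10 (lane plumbing)] -/
theorem sum_penTuples_mul_pow_le {β : ℝ} (hβ : 0 ≤ β) (v v₀ : ℕ → ℕ) (K : ℕ) : ∀ (r : ℕ) (v₁ : ℕ → ℕ),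
    ∑ k ∈ range (K + 1), (penTuples v v₀ v₁ (r + 2) k : ℝ) * β ^ k ≤
      (∑ j ∈ range (K + 1), (v₁ j : ℝ) * β ^ j) * (∑ j ∈ range (K + 1), (v j : ℝ) * β ^ j) ^ r *
        ∑ j ∈ range (K + 1), (v₀ j : ℝ) * β ^ j
  | 0, v₁ => by
    rw [pow_zero, mul_one]
    calc ∑ k ∈ range (K + 1), (penTuples v v₀ v₁ (0 + 2) k : ℝ) * β ^ k
        = ∑ k ∈ range (K + 1),
            ((∑ σ ∈ range (k + 1), v₁ σ * penTuples v v₀ v 1 (k - σ) : ℕ) : ℝ) * β ^ k := rfl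
      _ ≤ (∑ j ∈ range (K + 1), (v₁ j : ℝ) * β ^ j) *
            ∑ j ∈ range (K + 1), (penTuples v v₀ v 1 j : ℝ) * β ^ j :=
          sum_convolution_mul_pow_le hβ v₁ (penTuples v v₀ v 1) K
      _ = _ := rfl
  | r + 1, v₁ => by
    have ih := sum_penTuples_mul_pow_le hβ v v₀ K r v
    have hS0 : 0 ≤ ∑ j ∈ range (K + 1), (v₁ j : ℝ) * β ^ j :=
      Finset.sum_nonneg fun j _ => mul_nonneg (Nat.cast_nonneg _) (pow_nonneg hβ _)
    calc ∑ k ∈ range (K + 1), (penTuples v v₀ v₁ (r + 1 + 2) k : ℝ) * β ^ k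
        = ∑ k ∈ range (K + 1),
            ((∑ σ ∈ range (k + 1), v₁ σ * penTuples v v₀ v (r + 2) (k - σ) : ℕ) : ℝ) * β ^ k := rfl
      _ ≤ (∑ j ∈ range (K + 1), (v₁ j : ℝ) * β ^ j) *
            ∑ j ∈ range (K + 1), (penTuples v v₀ v (r + 2) j : ℝ) * β ^ j :=
          sum_convolution_mul_pow_le hβ v₁ (penTuples v v₀ v (r + 2)) K
      _ ≤ (∑ j ∈ range (K + 1), (v₁ j : ℝ) * β ^ j) *
            ((∑ j ∈ range (K + 1), (v j : ℝ) * β ^ j) * (∑ j ∈ range (K + 1), (v j : ℝ) * β ^ j) ^ r *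
              ∑ j ∈ range (K + 1), (v₀ j : ℝ) * β ^ j) :=
          mul_le_mul_of_nonneg_left ih hS0
      _ = _ := by ring

/-! ### From the decoration inequality to a lower bound on `μ`, at fugacity `β = 1/(2d−1)` -/

/-- `1 ≤ b_n (2d−1)^{−n}` (`b_0 = 1`, `b_n = 2d(2d−1)^{n−1}`): the NBW generating function diverges at `β = 1/μ₂`.
[cite: HaraSladeSokal1993, §2.3 p. 10 ("Here μ₂ = 2d − 1"); MadrasSlade1993, §1.2 (c_{N,2} = 2d(2d−1)^{N−1})] -/
theorem one_le_card_nbwWords_mul_pow (hd : 1 ≤ d) (n : ℕ) :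
    (1 : ℝ) ≤ ((nbwWords d n).card : ℝ) * (1 / (2 * (d : ℝ) - 1)) ^ n := by
  have hd1 : (1 : ℝ) ≤ d := by exact_mod_cast hd
  have hpos : (0 : ℝ) < 2 * (d : ℝ) - 1 := by linarith
  rcases Nat.eq_zero_or_pos n with rfl | hn
  · rw [Literature.Probability.FitznerVanDerHofstad2017.card_nbwWords_zero, pow_zero, Nat.cast_one, mul_one]
  · obtain ⟨k, rfl⟩ : ∃ k, n = k + 1 := ⟨n - 1, by omega⟩
    rw [card_nbwWords_eq d hn, Nat.add_sub_cancel]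
    have hcast : ((2 * d * (2 * d - 1) ^ k : ℕ) : ℝ) = 2 * (d : ℝ) * (2 * (d : ℝ) - 1) ^ k := by
      have h2 : 1 ≤ 2 * d := by omega
      push_cast [Nat.cast_sub h2]
      ring
    rw [hcast]
    have hk : (2 * (d : ℝ) - 1) ^ k * (1 / (2 * (d : ℝ) - 1)) ^ (k + 1) = 1 / (2 * (d : ℝ) - 1) := by
      rw [pow_succ, ← mul_assoc, ← mul_pow, mul_one_div_cancel hpos.ne', one_pow, one_mul]
    calc (1 : ℝ) ≤ 2 * (d : ℝ) * (1 / (2 * (d : ℝ) - 1)) := by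
          rw [mul_one_div, le_div_iff₀ hpos]; linarith
      _ = 2 * (d : ℝ) * (2 * (d : ℝ) - 1) ^ k * (1 / (2 * (d : ℝ) - 1)) ^ (k + 1) := by
          rw [mul_assoc (2 * (d : ℝ)), hk]

/-- **`N + 1 ≤ Σ_{m ≤ N} c_m β^m F(m)`** (`β = 1/(2d−1)`) whenever `b_n ≤ Σ_{m ≤ n} c_m L(m+1, n−m)` for all `n` and the
generating functions of `L(m+1, ·)` are bounded by `F(m)`. [cite: HaraSladeSokal1993, §2.4 eq. (2.37)–(2.39) p. 10–11] -/
theorem succ_le_sum_count_mul_pow_of_nbw (hd : 1 ≤ d) (L : ℕ → ℕ → ℕ) (F : ℕ → ℝ)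
    (hL : ∀ n, (nbwWords d n).card ≤ ∑ m ∈ range (n + 1), count d m * L (m + 1) (n - m))
    (hF : ∀ K m, ∑ k ∈ range (K + 1), (L (m + 1) k : ℝ) * (1 / (2 * (d : ℝ) - 1)) ^ k ≤ F m) (N : ℕ) :
    (N : ℝ) + 1 ≤ ∑ m ∈ range (N + 1), (count d m : ℝ) * (1 / (2 * (d : ℝ) - 1)) ^ m * F m := by
  set β : ℝ := 1 / (2 * (d : ℝ) - 1) with hβdef
  have hd1 : (1 : ℝ) ≤ d := by exact_mod_cast hd
  have hpos : (0 : ℝ) < 2 * (d : ℝ) - 1 := by linarith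
  have hβ : 0 ≤ β := (one_div_pos.2 hpos).le
  have hN : (N : ℝ) + 1 ≤ ∑ n ∈ range (N + 1), ((nbwWords d n).card : ℝ) * β ^ n := by
    have h1 : (N : ℝ) + 1 = ∑ _n ∈ range (N + 1), (1 : ℝ) := by simp
    rw [h1]
    exact Finset.sum_le_sum fun n _ => one_le_card_nbwWords_mul_pow hd n
  refine hN.trans ?_
  calc ∑ n ∈ range (N + 1), ((nbwWords d n).card : ℝ) * β ^ n
      ≤ ∑ n ∈ range (N + 1), ∑ m ∈ range (n + 1),
          ((count d m : ℝ) * β ^ m) * ((L (m + 1) (n - m) : ℝ) * β ^ (n - m)) := by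
        refine Finset.sum_le_sum fun n _ => ?_
        have h' : ((nbwWords d n).card : ℝ) ≤ ∑ m ∈ range (n + 1), (count d m : ℝ) * (L (m + 1) (n - m) : ℝ) := by
          exact_mod_cast hL n
        calc ((nbwWords d n).card : ℝ) * β ^ n
            ≤ (∑ m ∈ range (n + 1), (count d m : ℝ) * (L (m + 1) (n - m) : ℝ)) * β ^ n :=
              mul_le_mul_of_nonneg_right h' (pow_nonneg hβ _)
          _ = _ := by
              rw [Finset.sum_mul]
              refine Finset.sum_congr rfl fun m hm => ?_
              rw [Finset.mem_range] at hm
              rw [show β ^ n = β ^ m * β ^ (n - m) by rw [← pow_add]; congr 1; omega]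
              ring
    _ = ∑ m ∈ range (N + 1), ((count d m : ℝ) * β ^ m) *
          ∑ k ∈ range (N + 1 - m), (L (m + 1) k : ℝ) * β ^ k :=
        sum_sum_range_convolution N _ fun m k => (L (m + 1) k : ℝ) * β ^ k
    _ ≤ ∑ m ∈ range (N + 1), ((count d m : ℝ) * β ^ m) * F m := by
        refine Finset.sum_le_sum fun m hm => mul_le_mul_of_nonneg_left ?_
          (mul_nonneg (Nat.cast_nonneg _) (pow_nonneg hβ _))
        rw [Finset.mem_range] at hm
        rw [show N + 1 - m = N - m + 1 by omega]
        exact hF (N - m) m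

/-- **The limit argument at a general fugacity.** If `N + 1 ≤ Σ_{m ≤ N} c_m β^m · C W^m` for every `N` (`β, W > 0`,
`C ≥ 0`), then `1/(βW) ≤ μ(ℤ^d)`: otherwise `c_m ≤ θ^m` eventually with `ρ = θ β W < 1` and the right side stays bounded.
[cite: HaraSladeSokal1993, §2.4 eq. (2.39) p. 11 ("Arguing as before")] -/
theorem div_le_connectiveConstant_of (hd : 1 ≤ d) {β C W : ℝ} (hβ : 0 < β) (hC : 0 ≤ C) (hW : 0 < W)
    (h : ∀ N : ℕ, (N : ℝ) + 1 ≤ ∑ m ∈ range (N + 1), (count d m : ℝ) * β ^ m * (C * W ^ m)) :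
    1 / (β * W) ≤ connectiveConstant d := by
  haveI : NeZero d := ⟨by omega⟩
  by_contra hlt
  rw [not_le] at hlt
  have hμ0 : 0 < connectiveConstant d := connectiveConstant_pos d
  obtain ⟨θ, hμθ, hθ⟩ := exists_between hlt
  have hθ0 : 0 < θ := hμ0.trans hμθ
  have hβW : 0 < β * W := mul_pos hβ hW
  set ρ := θ * (β * W) with hρdef
  have hρ0 : 0 ≤ ρ := mul_nonneg hθ0.le hβW.le
  have hρ1 : ρ < 1 := (lt_div_iff₀ hβW).1 hθ
  -- eventually `c_m ≤ θ^m`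
  have hev : ∀ᶠ m : ℕ in atTop, (count d m : ℝ) ≤ θ ^ m := by
    have h1 := (tendsto_count_rpow d).eventually_mem (Iio_mem_nhds hμθ)
    filter_upwards [h1, eventually_ge_atTop 1] with m hm hm1
    rw [Set.mem_Iio] at hm
    have hc0 : 0 ≤ (count d m : ℝ) := Nat.cast_nonneg _
    have hm0 : (m : ℝ) ≠ 0 := by exact_mod_cast (by omega : m ≠ 0)
    calc (count d m : ℝ) = ((count d m : ℝ) ^ (1 / (m : ℝ))) ^ (m : ℝ) := by
          rw [← Real.rpow_mul hc0, one_div_mul_cancel hm0, Real.rpow_one]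
      _ = ((count d m : ℝ) ^ (1 / (m : ℝ))) ^ m := Real.rpow_natCast _ _
      _ ≤ θ ^ m := pow_le_pow_left₀ (Real.rpow_nonneg hc0 _) hm.le m
  obtain ⟨m₀, hm₀⟩ := Filter.eventually_atTop.1 hev
  -- the terms `a_m = c_m β^m C W^m` and their tail bound `a_m ≤ C ρ^m` (`m ≥ m₀`)
  set a : ℕ → ℝ := fun m => (count d m : ℝ) * β ^ m * (C * W ^ m) with hadef
  have ha0 : ∀ m, 0 ≤ a m := fun m =>
    mul_nonneg (mul_nonneg (Nat.cast_nonneg _) (pow_nonneg hβ.le m)) (mul_nonneg hC (pow_nonneg hW.le m))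
  have ha_tail : ∀ m, m₀ ≤ m → a m ≤ C * ρ ^ m := by
    intro m hm
    have e1 : a m = (count d m : ℝ) * (β * W) ^ m * C := by
      simp only [hadef]; rw [mul_pow]; ring
    have e2 : C * ρ ^ m = θ ^ m * (β * W) ^ m * C := by
      rw [hρdef, mul_pow]; ring
    rw [e1, e2]
    have hBW : 0 ≤ (β * W) ^ m * C := mul_nonneg (pow_nonneg hβW.le m) hC
    nlinarith [mul_le_mul_of_nonneg_right (hm₀ m hm) hBW]
  set C₀ := ∑ m ∈ range m₀, a m with hC₀
  have hbound : ∀ N : ℕ, (N : ℝ) + 1 ≤ C₀ + C / (1 - ρ) := by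
    intro N
    have h1 : (N : ℝ) + 1 ≤ ∑ m ∈ range (N + 1), a m := h N
    have hpt : ∀ m, a m ≤ (if m < m₀ then a m else 0) + C * ρ ^ m := by
      intro m
      split_ifs with h
      · linarith [mul_nonneg hC (pow_nonneg hρ0 m)]
      · rw [zero_add]; exact ha_tail m (by omega)
    have hsplit : ∑ m ∈ range (N + 1), a m ≤ C₀ + C * ∑ m ∈ range (N + 1), ρ ^ m := by
      calc ∑ m ∈ range (N + 1), a m
          ≤ ∑ m ∈ range (N + 1), ((if m < m₀ then a m else 0) + C * ρ ^ m) :=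
            Finset.sum_le_sum fun m _ => hpt m
        _ = (∑ m ∈ range (N + 1), if m < m₀ then a m else 0) + C * ∑ m ∈ range (N + 1), ρ ^ m := by
            rw [Finset.sum_add_distrib, Finset.mul_sum]
        _ ≤ C₀ + C * ∑ m ∈ range (N + 1), ρ ^ m := by
            refine add_le_add ?_ le_rfl
            rw [Finset.sum_ite, Finset.sum_const_zero, add_zero, hC₀]
            refine Finset.sum_le_sum_of_subset_of_nonneg ?_ (fun m _ _ => ha0 m)
            intro m hm
            simp only [Finset.mem_filter, Finset.mem_range] at hm ⊢
            exact hm.2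
    have hgeom : ∑ m ∈ range (N + 1), ρ ^ m ≤ 1 / (1 - ρ) := by
      rw [le_div_iff₀ (by linarith), geom_sum_mul_neg]
      linarith [pow_nonneg hρ0 (N + 1)]
    calc (N : ℝ) + 1 ≤ ∑ m ∈ range (N + 1), a m := h1
      _ ≤ C₀ + C * ∑ m ∈ range (N + 1), ρ ^ m := hsplit
      _ ≤ C₀ + C * (1 / (1 - ρ)) := by gcongr
      _ = C₀ + C / (1 - ρ) := by rw [mul_one_div]
  obtain ⟨N, hN⟩ := exists_nat_gt (C₀ + C / (1 - ρ))
  have := hbound N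
  linarith

/-! ### The memory-2 loop-erasure bound on `μ(ℤ^d)` -/

/-- `Σ_{j ≤ K} b_j(0) (2d−1)^{−j} ≤ B₀ := ((2d−2)/(2d−1)) G_d` (`d ≥ 3`) — HSS93 (2.14) at `x = 0`, `β = 1/(2d−1)`
(`≤`-half, partial sums), which is the tree's `sum_range_nbwCountR_threshold_le` (`NobleF3InitialPoint`).
[cite: HaraSladeSokal1993, §2.1 eq. (2.14) p. 6 ("C₂(0,x;1/(2d−1)) = ((2d−2)/(2d−1)) C₀(0,x;1/2d)")] -/
theorem sum_nbwLoopsAll_mul_pow_le (hd : 3 ≤ d) (K : ℕ) :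
    ∑ j ∈ range (K + 1), (nbwLoopsAll d j : ℝ) * (1 / (2 * (d : ℝ) - 1)) ^ j ≤
      (2 * (d : ℝ) - 2) / (2 * (d : ℝ) - 1) * srwI d 1 0 0 := by
  have h := sum_range_nbwCountR_threshold_le hd (K + 1) (0 : Site d)
  rw [nbwRho_def] at h
  calc ∑ j ∈ range (K + 1), (nbwLoopsAll d j : ℝ) * (1 / (2 * (d : ℝ) - 1)) ^ j
      = ∑ j ∈ range (K + 1), (1 / (2 * (d : ℝ) - 1)) ^ j * nbwCountR d j 0 := by
        refine Finset.sum_congr rfl fun j _ => ?_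
        rw [nbwLoopsAll_eq_card_nbwWordsTo, nbwCountR, mul_comm]
    _ ≤ (2 * (d : ℝ) - 2) / (2 * (d : ℝ) - 1) * srwI d 1 0 0 := h

/-- `b_0(0) = 1`. [cite: HaraSladeSokal1993, §2.1 eq. (2.2) p. 4 (lane plumbing)] -/
theorem nbwLoopsAll_zero : (nbwLoopsAll d 0 : ℝ) = 1 := by
  have h := nbwCountR_zero (d := d) (0 : Site d)
  rw [if_pos rfl, nbwCountR] at h
  rw [nbwLoopsAll_eq_card_nbwWordsTo]
  exact h

/-- **Hara–Slade–Sokal (2.39) with `τ = 2`, `k = 1` (second version): `μ(ℤ^d) ≥ (2d − 1)/W`** for every `d ≥ 3` and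
every bound `W > 0` on the partial sums `Σ_{j ≤ K} w̃_j (2d−1)^{−j}` of the penalised loop generating function
(`w̃_j = nbwLoopsPen d j`, the coefficients of `Π̃₂(1; ·)` taken as a maximum over the geometry). AS PRINTED: "Arguing as
before, we have `μ ≥ μ_τ/Π̃_τ(k; μ_τ^{−1})` for `τ = 2, k ≥ 0, d > 0` (2.39)", `μ₂ = 2d − 1`.
[cite: HaraSladeSokal1993, §2.4 eq. (2.39) p. 11 (τ = 2, k = 1) with (2.36)–(2.37) p. 10 and (2.14) p. 6] -/
theorem hss_memoryTwo_div_le_connectiveConstant (hd : 3 ≤ d) {W : ℝ} (hW0 : 0 < W)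
    (hW : ∀ K : ℕ, ∑ j ∈ range (K + 1), (nbwLoopsPen d j : ℝ) * (1 / (2 * (d : ℝ) - 1)) ^ j ≤ W) :
    (2 * (d : ℝ) - 1) / W ≤ connectiveConstant d := by
  set β : ℝ := 1 / (2 * (d : ℝ) - 1) with hβdef
  set B₀ : ℝ := (2 * (d : ℝ) - 2) / (2 * (d : ℝ) - 1) * srwI d 1 0 0 with hB₀def
  have hd3 : (3 : ℝ) ≤ d := by exact_mod_cast hd
  have hpos : (0 : ℝ) < 2 * (d : ℝ) - 1 := by linarith
  have hβ0 : 0 < β := one_div_pos.2 hpos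
  have hB₀ : ∀ K, ∑ j ∈ range (K + 1), (nbwLoopsAll d j : ℝ) * β ^ j ≤ B₀ := fun K =>
    sum_nbwLoopsAll_mul_pow_le hd K
  have hB₀1 : 1 ≤ B₀ := by
    have h := hB₀ 0
    rw [Finset.sum_range_one, pow_zero, mul_one, nbwLoopsAll_zero] at h
    exact h
  have hB₀0 : 0 ≤ B₀ := by linarith
  have hWi : 0 ≤ W⁻¹ := inv_nonneg.2 hW0.le
  set C : ℝ := B₀ * B₀ * (1 + W⁻¹) with hCdef
  have hC : 0 ≤ C := mul_nonneg (mul_nonneg hB₀0 hB₀0) (by linarith)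
  have key : 1 / (β * W) ≤ connectiveConstant d := by
    refine div_le_connectiveConstant_of (by omega) hβ0 hC hW0 ?_
    refine succ_le_sum_count_mul_pow_of_nbw (by omega)
      (penTuples (nbwLoopsPen d) (nbwLoopsAll d) (nbwLoopsAll d)) (fun m => C * W ^ m)
      card_nbwWords_le_sum ?_
    intro K m
    have hf0 : 0 ≤ ∑ j ∈ range (K + 1), (nbwLoopsAll d j : ℝ) * β ^ j :=
      Finset.sum_nonneg fun j _ => mul_nonneg (Nat.cast_nonneg _) (pow_nonneg hβ0.le _)
    have hg0 : 0 ≤ ∑ j ∈ range (K + 1), (nbwLoopsPen d j : ℝ) * β ^ j :=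
      Finset.sum_nonneg fun j _ => mul_nonneg (Nat.cast_nonneg _) (pow_nonneg hβ0.le _)
    cases m with
    | zero =>
      calc ∑ k ∈ range (K + 1), (penTuples (nbwLoopsPen d) (nbwLoopsAll d) (nbwLoopsAll d) (0 + 1) k : ℝ) * β ^ k
          = ∑ k ∈ range (K + 1), (nbwLoopsAll d k : ℝ) * β ^ k := rfl
        _ ≤ B₀ := hB₀ K
        _ ≤ C * W ^ 0 := by
            rw [pow_zero, mul_one, hCdef]
            have h1 : B₀ ≤ B₀ * B₀ := by nlinarith
            have h2 : B₀ * B₀ ≤ B₀ * B₀ * (1 + W⁻¹) := by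
              nlinarith [mul_nonneg (mul_nonneg hB₀0 hB₀0) hWi]
            exact h1.trans h2
    | succ r =>
      calc ∑ k ∈ range (K + 1), (penTuples (nbwLoopsPen d) (nbwLoopsAll d) (nbwLoopsAll d) (r + 1 + 1) k : ℝ) * β ^ k
          ≤ (∑ j ∈ range (K + 1), (nbwLoopsAll d j : ℝ) * β ^ j) *
              (∑ j ∈ range (K + 1), (nbwLoopsPen d j : ℝ) * β ^ j) ^ r *
              ∑ j ∈ range (K + 1), (nbwLoopsAll d j : ℝ) * β ^ j :=
            sum_penTuples_mul_pow_le hβ0.le (nbwLoopsPen d) (nbwLoopsAll d) K r (nbwLoopsAll d)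
        _ ≤ B₀ * W ^ r * B₀ := by
            have h1 := hB₀ K
            have h2 : (∑ j ∈ range (K + 1), (nbwLoopsPen d j : ℝ) * β ^ j) ^ r ≤ W ^ r :=
              pow_le_pow_left₀ hg0 (hW K) r
            exact mul_le_mul (mul_le_mul h1 h2 (pow_nonneg hg0 r) hB₀0) h1 hf0
              (mul_nonneg hB₀0 (pow_nonneg hW0.le r))
        _ = B₀ * B₀ * W⁻¹ * W ^ (r + 1) := by
            rw [pow_succ, show B₀ * B₀ * W⁻¹ * (W ^ r * W) = B₀ * W ^ r * B₀ * (W⁻¹ * W) by ring,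
              inv_mul_cancel₀ hW0.ne', mul_one]
        _ ≤ C * W ^ (r + 1) := by
            refine mul_le_mul_of_nonneg_right ?_ (pow_nonneg hW0.le _)
            rw [hCdef]
            nlinarith [mul_nonneg hB₀0 hB₀0]
  have e : 1 / (β * W) = (2 * (d : ℝ) - 1) / W := by
    rw [hβdef]
    field_simp
  rw [← e]
  exact key

/-- **Hara–Slade–Sokal (2.34), the Table 2 row `(2,0)`: `μ(ℤ^d) ≥ (2d−1)²/((2d−2) G_d)`** for every `d ≥ 3`
(`G_d = C₀(0,0;1/2d) = srwI d 1 0 0`). AS PRINTED: "`μ ≥ (2d−1)/C₂(0,0;1/(2d−1)) = (2d−1)²/(2d−2) · 1/C₀(0,0;1/2d)`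
(2.34). This bound is nontrivial for `d > 2`"; Table 2 row `(2,0)`: 4.121 641 (`d = 3`), 6.588 853, 8.756 316, 10.832 942
(`d = 6`) — here as a function of the tree's real number `G_d` (no decimal enclosure of `G_d` asserted).
[cite: HaraSladeSokal1993, §2.3 eq. (2.34) p. 10; Table 2 p. 12 row (2,0)] -/
theorem hss_two_zero_le_connectiveConstant (hd : 3 ≤ d) :
    (2 * (d : ℝ) - 1) ^ 2 / ((2 * (d : ℝ) - 2) * srwI d 1 0 0) ≤ connectiveConstant d := by
  have hd3 : (3 : ℝ) ≤ d := by exact_mod_cast hd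
  have hpos : (0 : ℝ) < 2 * (d : ℝ) - 1 := by linarith
  have hpos2 : (0 : ℝ) < 2 * (d : ℝ) - 2 := by linarith
  have hG1 : 1 ≤ srwI d 1 0 0 := one_le_srwI_one hd
  have hG0 : 0 < srwI d 1 0 0 := by linarith
  set B₀ : ℝ := (2 * (d : ℝ) - 2) / (2 * (d : ℝ) - 1) * srwI d 1 0 0 with hB₀def
  have hB₀0 : 0 < B₀ := mul_pos (div_pos hpos2 hpos) hG0
  have hW : ∀ K : ℕ, ∑ j ∈ range (K + 1), (nbwLoopsPen d j : ℝ) * (1 / (2 * (d : ℝ) - 1)) ^ j ≤ B₀ := by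
    intro K
    calc ∑ j ∈ range (K + 1), (nbwLoopsPen d j : ℝ) * (1 / (2 * (d : ℝ) - 1)) ^ j
        ≤ ∑ j ∈ range (K + 1), (nbwLoopsAll d j : ℝ) * (1 / (2 * (d : ℝ) - 1)) ^ j :=
          Finset.sum_le_sum fun j _ => mul_le_mul_of_nonneg_right (by exact_mod_cast nbwLoopsPen_le j)
            (pow_nonneg (one_div_pos.2 hpos).le _)
      _ ≤ B₀ := sum_nbwLoopsAll_mul_pow_le hd K
  have h := hss_memoryTwo_div_le_connectiveConstant hd hB₀0 hW
  have e : (2 * (d : ℝ) - 1) / B₀ = (2 * (d : ℝ) - 1) ^ 2 / ((2 * (d : ℝ) - 2) * srwI d 1 0 0) := by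
    rw [hB₀def]
    field_simp
  rw [← e]
  exact h

end Literature.Probability.RandomPlanarGeometry.SAW.Zd.LoopErasure

end
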